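import Literature.NumberTheory.Sieve.RoughOmegaCellsClasses
import Literature.NumberTheory.Sieve.RoughOmegaCellsDensityWeights
import Literature.NumberTheory.Sieve.PrimesInProgressionsFixedModulus
import HarnessLib

/-!
# Ω-cells of the rough integers are equidistributed in the reduced classes (bounded `u`)

Topic `Literature/NumberTheory/Sieve`. Everything here is PROVED. For a modulus `q ≥ 1` write
`Φ_j(X, Y; q, c) = #{b ∈ roughIcc ⌈Y⌉ ⌊X⌋ : Ω b = j, b ≡ c (q)}` and `Φ_j(X, Y)` for the full cell
(`roughIcc N X = {1 ≤ b ≤ X : p ∣ b ⇒ p ≥ N}`). The main theorem `exists_abs_cellClassDisc_le`: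

> for every `q ≥ 1` and `n` there is `C` with
> `|Φ_{j+1}(X, Y; q, c) − Φ_{j+1}(X, Y)/φ(q)| ≤ C X/log² Y`
> for all `2 ≤ Y ≤ X`, `log X ≤ n log Y`, `q < Y`, all `j` and all `(c, q) = 1`

(every `Y`-rough number with `Y > q` is prime to `q`, so only reduced classes occur). The proof is the
induction of Tenenbaum Ch. III.6 / Harman App. A.2 over Buchstab's identity sorted by `Ω`
(`RoughOmegaCellsClasses.lean`): the base range `log X ≤ 2 log Y` (`abs_cellClassDisc_base`: the cell
`Ω = 1` is the prime number theorem for progressions to the fixed modulus `q` in `π`-form, read off the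
tree's Bombieri–Vinogradov theorem; the other cells have at most one element), and the step
`n → n + 1` at `z = x^{1/n}` (`abs_cellClassDisc_step`), in which the cell `Ω = 1` is again the prime
number theorem for progressions and the cells `Ω ≥ 2` recurse to all cells at `(x/p, p)`, `y ≤ p < z`,
with `∑_{y ≤ p < z} 1/p = O(1)`. Sub-namespace `RoughCellsAP`.

## References

* K. Alladi, *The distribution of ν(n) in the sieve of Eratosthenes*, Quart. J. Math. Oxford (2) 33
  (1982), 129–148. [Alladi1982]
* G. Tenenbaum, *Introduction to analytic and probabilistic number theory*, 3rd ed., AMS GSM 163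
  (2015), Ch. III.6. [Tenenbaum2015]
* H. Iwaniec, E. Kowalski, *Analytic Number Theory*, AMS Coll. Publ. 53 (2004), Thm 17.1.
  [IwaniecKowalski2004]
-/

open Finset Filter
open scoped Chebyshev Topology ArithmeticFunction.Omega

noncomputable section

namespace Literature.NumberTheory.Sieve

namespace RoughCellsAP

/-! ### Trivial bounds -/

/-- The trivial bound `|Φ_j(X, Y; q, c) − Φ_j(X, Y)/φ(q)| ≤ X` (`X ≥ 0`): both counts lie in
`[0, ⌊X⌋]` and `φ(q) ≥ 1`. [folklore] -/
theorem abs_cellClassDisc_le_self {q : ℕ} (hq : 0 < q) {X : ℝ} (hX : 0 ≤ X) (Y : ℝ) (j c : ℕ) :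
    |(#((roughIcc ⌈Y⌉₊ ⌊X⌋₊).filter (fun b => Ω b = j ∧ b ≡ c [MOD q])) : ℝ) -
        (#((roughIcc ⌈Y⌉₊ ⌊X⌋₊).filter (fun b => Ω b = j)) : ℝ) / Nat.totient q| ≤ X := by
  have hφ : (1 : ℝ) ≤ Nat.totient q := by exact_mod_cast Nat.totient_pos.mpr hq
  have hcard : ∀ P : ℕ → Prop, ∀ _ : DecidablePred P,
      (#((roughIcc ⌈Y⌉₊ ⌊X⌋₊).filter P) : ℝ) ≤ X := by
    intro P _
    calc (#((roughIcc ⌈Y⌉₊ ⌊X⌋₊).filter P) : ℝ) ≤ #(Icc 1 ⌊X⌋₊) := by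
          exact_mod_cast card_le_card ((filter_subset _ _).trans (roughIcc_subset_Icc _ _))
      _ = ⌊X⌋₊ := by simp
      _ ≤ X := Nat.floor_le hX
  have hA := hcard (fun b => Ω b = j ∧ b ≡ c [MOD q]) inferInstance
  have hB := hcard (fun b => Ω b = j) inferInstance
  have hA0 : (0 : ℝ) ≤ #((roughIcc ⌈Y⌉₊ ⌊X⌋₊).filter (fun b => Ω b = j ∧ b ≡ c [MOD q])) :=
    Nat.cast_nonneg _
  have hB0 : (0 : ℝ) ≤ #((roughIcc ⌈Y⌉₊ ⌊X⌋₊).filter (fun b => Ω b = j)) := Nat.cast_nonneg _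
  have hB1 : (#((roughIcc ⌈Y⌉₊ ⌊X⌋₊).filter (fun b => Ω b = j)) : ℝ) / Nat.totient q ≤ X :=
    (div_le_self hB0 hφ).trans hB
  have hB2 : 0 ≤ (#((roughIcc ⌈Y⌉₊ ⌊X⌋₊).filter (fun b => Ω b = j)) : ℝ) / Nat.totient q := by
    positivity
  rw [abs_le]
  constructor <;> linarith

/-- For `2 ≤ Y ≤ X` with `Y < e²` the trivial bound reads `|…| ≤ 4 X/log² Y` (`log Y < 2`).
[folklore] -/
theorem abs_cellClassDisc_le_of_lt_exp_two {q : ℕ} (hq : 0 < q) {X Y : ℝ} (hY : 2 ≤ Y) (hYX : Y ≤ X)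
    (hY2 : Y < Real.exp 2) (j c : ℕ) :
    |(#((roughIcc ⌈Y⌉₊ ⌊X⌋₊).filter (fun b => Ω b = j ∧ b ≡ c [MOD q])) : ℝ) -
        (#((roughIcc ⌈Y⌉₊ ⌊X⌋₊).filter (fun b => Ω b = j)) : ℝ) / Nat.totient q| ≤
      4 * X / Real.log Y ^ 2 := by
  have hX0 : 0 ≤ X := by linarith
  have hY0 : 0 < Y := by linarith
  have hlY0 : 0 < Real.log Y := Real.log_pos (by linarith)
  have hlY2 : Real.log Y < 2 := by rw [Real.log_lt_iff_lt_exp hY0]; exact hY2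
  refine (abs_cellClassDisc_le_self hq hX0 Y j c).trans ?_
  rw [le_div_iff₀ (by positivity)]
  have : Real.log Y ^ 2 ≤ 4 := by nlinarith
  nlinarith

/-! ### The base range `log X ≤ 2 log Y` -/

/-- Two counts that are `0` or `1`: `|A − B/φ| ≤ 1` for naturals `A, B ≤ 1` and `φ ≥ 1`. [folklore] -/
theorem abs_natCast_sub_div_le_one {A B φ : ℕ} (hA : A ≤ 1) (hB : B ≤ 1) (hφ : 1 ≤ φ) :
    |(A : ℝ) - (B : ℝ) / φ| ≤ 1 := by
  have hA' : (A : ℝ) ≤ 1 := by exact_mod_cast hA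
  have hB' : (B : ℝ) ≤ 1 := by exact_mod_cast hB
  have hφ' : (1 : ℝ) ≤ φ := by exact_mod_cast hφ
  have h1 : (B : ℝ) / φ ≤ 1 := by
    rw [div_le_one (by linarith)]
    linarith
  have h2 : 0 ≤ (B : ℝ) / φ := by positivity
  have h3 : (0 : ℝ) ≤ A := Nat.cast_nonneg A
  rw [abs_le]
  constructor <;> linarith

/-- `1 ≤ 4 X / log² Y` for `1 ≤ Y ≤ X` (`log² Y ≤ 4Y ≤ 4X`). [folklore] -/
theorem one_le_four_mul_div_log_sq {X Y : ℝ} (hY : 1 < Y) (hYX : Y ≤ X) :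
    (1 : ℝ) ≤ 4 * X / Real.log Y ^ 2 := by
  have hlY : 0 < Real.log Y := Real.log_pos hY
  rw [le_div_iff₀ (by positivity), one_mul]
  exact log_sq_le_four_mul_of_one_le hY.le hYX

/-- **The base range.** With the constant `C` of `exists_abs_primeCountingDisc_le`: for
`2 ≤ Y ≤ X`, `log X ≤ 2 log Y` and `(c, q) = 1`, every cell satisfies
`|D_j(X, Y; q, c)| ≤ (2C + 4) X/log² Y` — the cell `Ω = 1` by `abs_primes_class_sub_le`, while for
`j = 0` (the cell `{1}`) and `j ≥ 2` (at most one element, as `X ≤ Y²`) both counts are `≤ 1`.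
[folklore] -/
theorem abs_cellClassDisc_base {q : ℕ} (hq : 0 < q) {C : ℝ} (hC0 : 0 ≤ C)
    (hC : ∀ x : ℝ, 2 ≤ x → ∀ n : ℕ, (n : ℝ) ≤ x → ∀ a : (ZMod q)ˣ,
      |primeCountingDisc q a n| ≤ C * x / Real.log x ^ 2)
    {X Y : ℝ} (hY : 2 ≤ Y) (hYX : Y ≤ X) (hXY : Real.log X ≤ 2 * Real.log Y) (j : ℕ) {c : ℕ}
    (hc : c.Coprime q) :
    |(#((roughIcc ⌈Y⌉₊ ⌊X⌋₊).filter (fun b => Ω b = j ∧ b ≡ c [MOD q])) : ℝ) -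
        (#((roughIcc ⌈Y⌉₊ ⌊X⌋₊).filter (fun b => Ω b = j)) : ℝ) / Nat.totient q| ≤
      (2 * C + 4) * X / Real.log Y ^ 2 := by
  have hY1 : 1 < Y := by linarith
  have hY0 : 0 < Y := by linarith
  have hX0 : 0 ≤ X := by linarith
  have hlY : 0 < Real.log Y := Real.log_pos hY1
  have hφ : 1 ≤ Nat.totient q := Nat.totient_pos.mpr hq
  have hone : (1 : ℝ) ≤ 4 * X / Real.log Y ^ 2 := one_le_four_mul_div_log_sq hY1 hYX
  have hsplit : (2 * C + 4) * X / Real.log Y ^ 2 =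
      2 * C * X / Real.log Y ^ 2 + 4 * X / Real.log Y ^ 2 := by ring
  have hCX : 0 ≤ 2 * C * X / Real.log Y ^ 2 := by positivity
  set N := ⌈Y⌉₊ with hN
  set XX := ⌊X⌋₊ with hXX
  -- the class cell sits inside the cell
  have hsub : (roughIcc N XX).filter (fun b => Ω b = j ∧ b ≡ c [MOD q]) ⊆
      (roughIcc N XX).filter (fun b => Ω b = j) :=
    Finset.monotone_filter_right _ fun b _ hb => hb.1
  rcases Nat.lt_trichotomy j 1 with hj | rfl | hj
  · -- `j = 0`: the cell is `{1}`
    have hj0 : j = 0 := by omega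
    subst hj0
    have hXX1 : 1 ≤ XX := by
      rw [hXX]
      exact Nat.le_floor (by norm_num; linarith)
    have hB : #((roughIcc N XX).filter (fun b => Ω b = 0)) ≤ 1 := by
      rw [roughIcc_filter_cardFactors_zero N hXX1, card_singleton]
    have hA : #((roughIcc N XX).filter (fun b => Ω b = 0 ∧ b ≡ c [MOD q])) ≤ 1 :=
      (card_le_card hsub).trans hB
    rw [hsplit]
    exact (abs_natCast_sub_div_le_one hA hB hφ).trans (by linarith)
  · -- `j = 1`: primes
    have hA : (roughIcc N XX).filter (fun b => Ω b = 1 ∧ b ≡ c [MOD q]) =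
        (Icc N XX).filter (fun p => p.Prime ∧ p ≡ c [MOD q]) := by
      rw [← filter_filter, roughIcc_filter_cardFactors_one, filter_filter]
    rw [hA, roughIcc_filter_cardFactors_one, hsplit]
    exact (abs_primes_class_sub_le hC0 hC hY hYX hc).trans (by linarith)
  · -- `j ≥ 2`: at most one element since `X ≤ Y²`
    have hXY' : X ≤ Y ^ 2 := by
      have h1 : Real.log X ≤ Real.log (Y ^ 2) := by rw [Real.log_pow]; push_cast; linarith
      rcases le_or_gt X 0 with hx | hx
      · exact hx.trans (by positivity)
      · exact (Real.log_le_log_iff hx (by positivity)).mp h1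
    have hXXN : XX ≤ N * N := by
      refine Nat.floor_le_of_le ?_
      push_cast
      calc X ≤ Y ^ 2 := hXY'
        _ = Y * Y := sq Y
        _ ≤ N * N := mul_le_mul (Nat.le_ceil Y) (Nat.le_ceil Y) hY0.le (Nat.cast_nonneg _)
    have hB : #((roughIcc N XX).filter (fun b => Ω b = j)) ≤ 1 :=
      card_roughIcc_filter_cardFactors_le_one hXXN (by omega)
    have hA : #((roughIcc N XX).filter (fun b => Ω b = j ∧ b ≡ c [MOD q])) ≤ 1 :=
      (card_le_card hsub).trans hB
    rw [hsplit]
    exact (abs_natCast_sub_div_le_one hA hB hφ).trans (by linarith)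

/-! ### The self-contained Buchstab step -/

/-- **The Buchstab step `n → n + 1` (main case) for the cells `Ω = j + 2`.** Assume the class
discrepancies of all cells `Ω = i + 1` are `≤ C X/log² Y` for `2 ≤ Y ≤ X`, `log X ≤ n log Y`, `q < Y`
(`n ≥ 2`). Then for `e² ≤ y ≤ x`, `n log y < log x ≤ (n + 1) log y`, `q < y` the cells `Ω = j + 2`
satisfy `|Φ_{j+2}(x, y; q, c) − Φ_{j+2}(x, y)/φ(q)| ≤ C (4 + 8C₀) x/log² y` (Buchstab's identity at
`z = x^{1/n}`; the parameters `a = ⌈y⌉ − 1`, `b = ⌈z⌉ − 1` as in `abs_card_roughIcc_sub_main_step`).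
[folklore] -/
theorem abs_cellClassDisc_step {q : ℕ} (hq : 0 < q) {n : ℕ} (hn : 2 ≤ n) {C C₀ : ℝ} (hC : 0 ≤ C)
    (hC₀ : 0 ≤ C₀) (hE : ∀ t : ℝ, 2 ≤ t → |θ t - t| ≤ C₀ * t / Real.log t ^ 2)
    (hP : ∀ X Y : ℝ, 2 ≤ Y → Y ≤ X → Real.log X ≤ n * Real.log Y → (q : ℝ) < Y →
      ∀ i c : ℕ, c.Coprime q →
        |(#((roughIcc ⌈Y⌉₊ ⌊X⌋₊).filter (fun b => Ω b = i + 1 ∧ b ≡ c [MOD q])) : ℝ) -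
            (#((roughIcc ⌈Y⌉₊ ⌊X⌋₊).filter (fun b => Ω b = i + 1)) : ℝ) / Nat.totient q| ≤
          C * X / Real.log Y ^ 2)
    {x y : ℝ} (hy : Real.exp 2 ≤ y) (hyx : y ≤ x) (hkxy : n * Real.log y < Real.log x)
    (hxy : Real.log x ≤ (n + 1) * Real.log y) (hqy : (q : ℝ) < y) (j : ℕ) {c : ℕ}
    (hc : c.Coprime q) :
    |(#((roughIcc ⌈y⌉₊ ⌊x⌋₊).filter (fun b => Ω b = j + 1 + 1 ∧ b ≡ c [MOD q])) : ℝ) -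
        (#((roughIcc ⌈y⌉₊ ⌊x⌋₊).filter (fun b => Ω b = j + 1 + 1)) : ℝ) / Nat.totient q| ≤
      C * (1 + ((1 + 2 * C₀) * 3 + 2 * C₀)) * x / Real.log y ^ 2 := by
  -- numerics about `y`, `x` (as in `abs_card_roughIcc_sub_main_step`)
  have hk2 : (2 : ℝ) ≤ n := by exact_mod_cast hn
  have hk0 : (0 : ℝ) < n := by linarith
  have he1 : (2 : ℝ) ≤ Real.exp 1 := by have := Real.add_one_le_exp (1 : ℝ); linarith
  have he2 : Real.exp 1 ≤ Real.exp 2 - 1 := by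
    have h2 : Real.exp 2 = Real.exp 1 * Real.exp 1 := by rw [← Real.exp_add]; norm_num
    nlinarith
  have hy0 : 0 < y := (Real.exp_pos 2).trans_le hy
  have hy3 : 3 ≤ y := le_trans (by have := Real.add_one_le_exp (2 : ℝ); linarith) hy
  have hy2 : 2 ≤ y := by linarith
  have hly2 : 2 ≤ Real.log y := by rw [Real.le_log_iff_exp_le hy0]; exact hy
  have hly : 0 < Real.log y := by linarith
  have hLx : 0 < Real.log x := by
    have : (n : ℝ) * Real.log y ≥ 2 * 2 := mul_le_mul hk2 hly2 (by norm_num) hk0.le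
    linarith
  have hx1 : 1 < x := by linarith
  have hx0 : 0 < x := by linarith
  -- `z = x^{1/n}`
  set z : ℝ := Real.exp (Real.log x / n) with hz_def
  have hz0 : 0 < z := Real.exp_pos _
  have hz_log : Real.log z = Real.log x / n := Real.log_exp _
  have hyz : y < z := by
    have h : Real.log y < Real.log x / n := by rw [lt_div_iff₀ hk0]; linarith
    calc y = Real.exp (Real.log y) := (Real.exp_log hy0).symm
      _ < z := Real.exp_lt_exp.mpr h
  have hzz : z * z ≤ x := by
    have h : Real.log x / n + Real.log x / n ≤ Real.log x := by
      rw [← two_mul, ← mul_div_assoc, div_le_iff₀ hk0]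
      have : Real.log x * 2 ≤ Real.log x * n := mul_le_mul_of_nonneg_left hk2 hLx.le
      linarith
    calc z * z = Real.exp (Real.log x / n + Real.log x / n) := by rw [Real.exp_add]
      _ ≤ Real.exp (Real.log x) := Real.exp_le_exp.mpr h
      _ = x := Real.exp_log hx0
  have hz1 : 1 ≤ z := by linarith
  have hzx : z ≤ x := le_trans (le_mul_of_one_le_left hz0.le hz1) hzz
  have hz2 : (2 : ℝ) ≤ z := by linarith
  have hxz : Real.log x ≤ n * Real.log z := by rw [hz_log]; field_simp; exact le_rfl
  -- `N = ⌈y⌉`, `M = ⌈z⌉`, `a = N − 1`, `b = M − 1`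
  set N := ⌈y⌉₊ with hN
  set M := ⌈z⌉₊ with hM
  have hN1 : 0 < N := Nat.ceil_pos.mpr hy0
  have hM1 : 0 < M := Nat.ceil_pos.mpr hz0
  have hNM : N ≤ M := Nat.ceil_le_ceil hyz.le
  set a : ℝ := ((N - 1 : ℕ) : ℝ) with ha_def
  set b : ℝ := ((M - 1 : ℕ) : ℝ) with hb_def
  have haN : a = (N : ℝ) - 1 := by rw [ha_def, Nat.cast_sub hN1, Nat.cast_one]
  have hbM : b = (M : ℝ) - 1 := by rw [hb_def, Nat.cast_sub hM1, Nat.cast_one]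
  have hyN : y ≤ N := Nat.le_ceil y
  have hNy : (N : ℝ) < y + 1 := Nat.ceil_lt_add_one hy0.le
  have hzM : z ≤ M := Nat.le_ceil z
  have hMz : (M : ℝ) < z + 1 := Nat.ceil_lt_add_one hz0.le
  have hbz : b < z := by rw [hbM]; linarith
  have hab : a ≤ b := by
    rw [haN, hbM]
    have : (N : ℝ) ≤ M := by exact_mod_cast hNM
    linarith
  have hea : Real.exp 1 ≤ a := by rw [haN]; linarith
  have ha0 : 0 < a := (Real.exp_pos 1).trans_le hea
  have hasq : y ≤ a ^ 2 := by
    have h1 : y - 1 ≤ a := by rw [haN]; linarith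
    have h2 : (y - 1) ^ 2 ≤ a ^ 2 := pow_le_pow_left₀ (by linarith) h1 2
    have h3 : y ≤ (y - 1) ^ 2 := by nlinarith
    exact h3.trans h2
  have hlya : Real.log y ≤ 2 * Real.log a := by
    calc Real.log y ≤ Real.log (a ^ 2) := Real.log_le_log hy0 hasq
      _ = 2 * Real.log a := by rw [Real.log_pow]; norm_num
  have hxa : Real.log x ≤ 2 * (n + 1) * Real.log a := by
    calc Real.log x ≤ (n + 1) * Real.log y := hxy
      _ ≤ (n + 1) * (2 * Real.log a) := by gcongr
      _ = 2 * (n + 1) * Real.log a := by ring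
  have hb0 : 0 < b := ha0.trans_le hab
  have hlb : Real.log b ≤ 3 * Real.log a := by
    have h1 : (n : ℝ) * Real.log b < Real.log x := by
      calc (n : ℝ) * Real.log b < n * Real.log z :=
            mul_lt_mul_of_pos_left (Real.log_lt_log hb0 hbz) hk0
        _ = Real.log x := by rw [hz_log]; field_simp
    have hla : 1 ≤ Real.log a := by rw [Real.le_log_iff_exp_le ha0]; exact hea
    have hkl : 2 * Real.log a ≤ (n : ℝ) * Real.log a :=
      mul_le_mul_of_nonneg_right hk2 (by linarith)
    have h2 : Real.log x ≤ (n : ℝ) * (3 * Real.log a) := by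
      calc Real.log x ≤ 2 * (n + 1) * Real.log a := hxa
        _ ≤ (n : ℝ) * (3 * Real.log a) := by linarith
    exact (lt_of_mul_lt_mul_left (h1.trans_le h2) hk0.le).le
  -- the index set of primes `y ≤ p < z`
  have hfloor_a : ⌊a⌋₊ = N - 1 := by rw [ha_def, Nat.floor_natCast]
  have hfloor_b : ⌊b⌋₊ = M - 1 := by rw [hb_def, Nat.floor_natCast]
  have hS : (Finset.Ico N M).filter Nat.Prime = (Finset.Ioc ⌊a⌋₊ ⌊b⌋₊).filter Nat.Prime := by
    rw [hfloor_a, hfloor_b]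
    congr 1
    ext p
    simp only [Finset.mem_Ico, Finset.mem_Ioc]
    omega
  have hpS : ∀ p ∈ (Finset.Ioc ⌊a⌋₊ ⌊b⌋₊).filter Nat.Prime,
      p.Prime ∧ y ≤ (p : ℝ) ∧ (p : ℝ) < z := by
    intro p hp
    rw [Finset.mem_filter, Finset.mem_Ioc, hfloor_a, hfloor_b] at hp
    obtain ⟨⟨h1, h2⟩, hp'⟩ := hp
    refine ⟨hp', ?_, ?_⟩
    · have : N ≤ p := by omega
      calc y ≤ N := hyN
        _ ≤ p := by exact_mod_cast this
    · have : p + 1 ≤ M := by omega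
      have : (p : ℝ) + 1 ≤ M := by exact_mod_cast this
      linarith
  exact abs_cellClassDisc_step_of hq hC hC₀ hE hP hN.symm hM.symm hNM hS hx0 hy2 hqy hz2 hzx hzz
    hyz hxz hxy hea hab hlb hpS j hc

/-! ### The induction and the final statement -/

/-- **The `Ω`-cells of the rough integers are equidistributed in the reduced classes** (bounded
`u = log X/log Y`): for every `q ≥ 1` and every `n` there is `C ≥ 0` such that
`|Φ_{j+1}(X, Y; q, c) − Φ_{j+1}(X, Y)/φ(q)| ≤ C X/log² Y`
for all `2 ≤ Y ≤ X` with `log X ≤ n log Y` and `q < Y`, all `j` and all `(c, q) = 1`, where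
`Φ_j(X, Y; q, c) = #{b ∈ roughIcc ⌈Y⌉ ⌊X⌋ : Ω b = j, b ≡ c (q)}` (induction on `n ≥ 2` from
`abs_cellClassDisc_base` by `abs_cellClassDisc_step`; the cell `Ω = 1` is `abs_primes_class_sub_le` at
every level; Tenenbaum Ch. III.6 with the prime number theorem for progressions as input).
[folklore] -/
theorem exists_abs_cellClassDisc_le (q : ℕ) (hq : 0 < q) (n : ℕ) :
    ∃ C : ℝ, 0 ≤ C ∧ ∀ X Y : ℝ, 2 ≤ Y → Y ≤ X → Real.log X ≤ n * Real.log Y → (q : ℝ) < Y →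
      ∀ j c : ℕ, c.Coprime q →
        |(#((roughIcc ⌈Y⌉₊ ⌊X⌋₊).filter (fun b => Ω b = j + 1 ∧ b ≡ c [MOD q])) : ℝ) -
            (#((roughIcc ⌈Y⌉₊ ⌊X⌋₊).filter (fun b => Ω b = j + 1)) : ℝ) / Nat.totient q| ≤
          C * X / Real.log Y ^ 2 := by
  obtain ⟨C₀, hC₀, hE⟩ := Literature.NumberTheory.LFunctions.exists_abs_theta_sub_self_le_div_log_sq
  obtain ⟨Cπ, hCπ0, hCπ⟩ := exists_abs_primeCountingDisc_le q hq
  -- it suffices to treat `n ≥ 2`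
  suffices hmain : ∀ m : ℕ, 2 ≤ m → ∃ C : ℝ, 0 ≤ C ∧ ∀ X Y : ℝ, 2 ≤ Y → Y ≤ X →
      Real.log X ≤ m * Real.log Y → (q : ℝ) < Y → ∀ j c : ℕ, c.Coprime q →
        |(#((roughIcc ⌈Y⌉₊ ⌊X⌋₊).filter (fun b => Ω b = j + 1 ∧ b ≡ c [MOD q])) : ℝ) -
            (#((roughIcc ⌈Y⌉₊ ⌊X⌋₊).filter (fun b => Ω b = j + 1)) : ℝ) / Nat.totient q| ≤
          C * X / Real.log Y ^ 2 by
    obtain ⟨C, hC, h⟩ := hmain (max n 2) (le_max_right _ _)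
    refine ⟨C, hC, fun X Y hY hYX hXY hqY j c hc => h X Y hY hYX (hXY.trans ?_) hqY j c hc⟩
    have hlY : 0 ≤ Real.log Y := Real.log_nonneg (by linarith)
    exact mul_le_mul_of_nonneg_right (by exact_mod_cast le_max_left n 2) hlY
  intro m hm
  induction m, hm using Nat.le_induction with
  | base =>
    refine ⟨2 * Cπ + 4, by positivity, fun X Y hY hYX hXY _ j c hc => ?_⟩
    exact abs_cellClassDisc_base hq hCπ0 hCπ hY hYX (by exact_mod_cast hXY) (j + 1) hc
  | succ k hk ih =>
    obtain ⟨C, hC, hPk⟩ := ih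
    set K : ℝ := (1 + 2 * C₀) * 3 + 2 * C₀ with hK
    have hK0 : 0 ≤ K := by positivity
    refine ⟨C * (1 + K) + 2 * Cπ + 4, by positivity, fun X Y hY hYX hXY hqY j c hc => ?_⟩
    push_cast at hXY
    have hX0 : 0 ≤ X := by linarith
    have hlY : 0 < Real.log Y := Real.log_pos (by linarith)
    have hCC : C ≤ C * (1 + K) + 2 * Cπ + 4 := by nlinarith
    by_cases h1 : Real.log X ≤ k * Real.log Y
    · refine (hPk X Y hY hYX h1 hqY j c hc).trans ?_
      rw [div_le_div_iff_of_pos_right (by positivity)]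
      exact mul_le_mul_of_nonneg_right hCC hX0
    push Not at h1
    rcases lt_or_ge Y (Real.exp 2) with h2 | h2
    · refine (abs_cellClassDisc_le_of_lt_exp_two hq hY hYX h2 (j + 1) c).trans ?_
      rw [div_le_div_iff_of_pos_right (by positivity)]
      refine mul_le_mul_of_nonneg_right ?_ hX0
      nlinarith
    rcases j with _ | j
    · -- the cell `Ω = 1`: primes in a progression
      have hA : (roughIcc ⌈Y⌉₊ ⌊X⌋₊).filter (fun b => Ω b = 0 + 1 ∧ b ≡ c [MOD q]) =
          (Icc ⌈Y⌉₊ ⌊X⌋₊).filter (fun p => p.Prime ∧ p ≡ c [MOD q]) := by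
        rw [← filter_filter, Nat.zero_add, roughIcc_filter_cardFactors_one, filter_filter]
      rw [hA, Nat.zero_add, roughIcc_filter_cardFactors_one]
      refine (abs_primes_class_sub_le hCπ0 hCπ hY hYX hc).trans ?_
      rw [div_le_div_iff_of_pos_right (by positivity)]
      refine mul_le_mul_of_nonneg_right ?_ hX0
      nlinarith
    · -- the cells `Ω = j + 2`: the Buchstab step
      refine (abs_cellClassDisc_step hq hk hC hC₀ hE hPk h2 hYX h1 hXY hqY j hc).trans ?_
      rw [div_le_div_iff_of_pos_right (by positivity)]
      refine mul_le_mul_of_nonneg_right ?_ hX0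
      rw [← hK]
      nlinarith

end RoughCellsAP

end Literature.NumberTheory.Sieve
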